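import Literature.Analysis.FluidPDE.MixedNormSmooth
import HarnessLib

/-!
# Mixed norms from slice bounds: `L^q_t L^p_x` estimates by a time profile

Analysis/FluidPDE support file (all proved, [folklore]) complementing `MixedNormSmooth`: how to
bound the accepted mixed norms `Torus.eLqLpNorm q p Z (Ioo 0 T)` once every time slice has been
estimated by an explicit nonnegative time profile `φ`, `‖Z(t)‖_{L^p(𝕋^d)} ≤ φ(t)`:

* `eLqLpNorm_le_eLpNorm_of_slice_le` — `‖Z‖_{L^q(0,T;L^p)} ≤ ‖φ‖_{L^q(0,T)}` (any `q`);
* `eLqLpNorm_one_le_ofReal_integral_of_slice_le` — `‖Z‖_{L¹(0,T;L^p)} ≤ ∫₀ᵀ φ`;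
* the `L^q(0,T)` norms of the profiles that occur: constants
  (`eLpNorm_const_restrict_Ioo_le`: `≤ max(1,T)|c|`) and continuous profiles through interval
  integrals (`eLpNorm_restrict_Ioo_eq_ofReal_rpow`, `q ≥ 1` real), plus Minkowski on `(0,T)`;
* slice tools on the probability space `𝕋^d`: `‖f • v‖_p = ‖v‖ ‖f‖_p` for a fixed vector `v`,
  `‖a • f‖_p ≤ (sup|a|) ‖f‖_p` (for real `f` cf. `Torus.eLpNorm_mul_le_of_abs_le` of `WeakTimeProductRule`), and
  `‖f‖_p ≤ ‖f‖_{p'}` for `p ≤ p'` (for `‖f‖_p ≤ sup‖f‖` use `Torus.eLpNorm_le_of_forall_norm_le` of `TorusForceBookkeeping`).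

These are the bookkeeping steps of Cheskidov–Luo 2022, §5 ("taking `L^p` in time", Props. 5.3–5.5,
Lemmas 5.6–5.8), isolated from the specific fields.

## References

* A. Cheskidov, X. Luo, arXiv:2009.06596, §5.2–§5.3. [`CheskidovLuo2022`]
* J. Serrin, *The initial value problem for the Navier–Stokes equations* (1963), §3 (mixed norms).
-/

noncomputable section

open MeasureTheory Set Filter Topology
open scoped ENNReal NNReal

namespace Literature.Analysis.FluidPDE

namespace Torus

variable {d : Type*} [Fintype d]

/-! ## From slice bounds to mixed norms -/

section Slices

variable {F : Type*} [NormedAddCommGroup F] {T : ℝ} {Z : ℝ → UnitAddTorus d → F} {φ : ℝ → ℝ} {p q : ℝ≥0∞}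

/-- **Mixed norms from slice bounds**: if `‖Z(t)‖_{L^p} ≤ φ(t)` with `φ ≥ 0` on `(0,T)`, then
`‖Z‖_{L^q(0,T;L^p)} ≤ ‖φ‖_{L^q(0,T)}`. [folklore] -/
theorem eLqLpNorm_le_eLpNorm_of_slice_le (hφ0 : ∀ t ∈ Ioo 0 T, 0 ≤ φ t)
    (hle : ∀ t ∈ Ioo 0 T, eLpNorm (Z t) p volume ≤ ENNReal.ofReal (φ t)) :
    eLqLpNorm q p Z (Ioo 0 T) ≤ eLpNorm φ q (volume.restrict (Ioo 0 T)) := by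
  rw [eLqLpNorm, FluidPDE.eLqLpNorm]
  refine eLpNorm_mono_ae (ae_restrict_of_forall_mem measurableSet_Ioo fun t ht => ?_)
  rw [Real.norm_of_nonneg ENNReal.toReal_nonneg, Real.norm_of_nonneg (hφ0 t ht)]
  exact ENNReal.toReal_le_of_le_ofReal (hφ0 t ht) (hle t ht)

/-- **`L¹_t` mixed norms from slice bounds**: if `‖Z(t)‖_{L^p} ≤ φ(t)` with `φ ≥ 0` continuous on
`[0,T]`, `T ≥ 0`, then `‖Z‖_{L¹(0,T;L^p)} ≤ ∫₀ᵀ φ`. [folklore] -/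
theorem eLqLpNorm_one_le_ofReal_integral_of_slice_le (hT : 0 ≤ T) (hφc : ContinuousOn φ (Icc 0 T))
    (hφ0 : ∀ t ∈ Ioo 0 T, 0 ≤ φ t) (hle : ∀ t ∈ Ioo 0 T, eLpNorm (Z t) p volume ≤ ENNReal.ofReal (φ t)) :
    eLqLpNorm 1 p Z (Ioo 0 T) ≤ ENNReal.ofReal (∫ t in (0 : ℝ)..T, φ t) := by
  refine (eLqLpNorm_le_eLpNorm_of_slice_le hφ0 hle).trans (le_of_eq ?_)
  have hint : IntegrableOn φ (Ioo 0 T) volume := (hφc.integrableOn_compact isCompact_Icc).mono_set Ioo_subset_Icc_self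
  rw [eLpNorm_one_eq_lintegral_enorm, intervalIntegral.integral_of_le hT, integral_Ioc_eq_integral_Ioo,
    ofReal_integral_eq_lintegral_ofReal hint (ae_restrict_of_forall_mem measurableSet_Ioo hφ0)]
  refine setLIntegral_congr_fun measurableSet_Ioo fun t ht => ?_
  rw [Real.enorm_eq_ofReal_abs, abs_of_nonneg (hφ0 t ht)]

end Slices

/-! ## `L^q(0,T)` norms of time profiles -/

section Time

variable {T : ℝ} {φ ψ : ℝ → ℝ} {q : ℝ≥0∞}

/-- Constants on `(0,T)`: `‖c‖_{L^q(0,T)} ≤ max(1,T) |c|` for `q ≥ 1`. [folklore] -/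
theorem eLpNorm_const_restrict_Ioo_le (c : ℝ) (hq : 1 ≤ q) :
    eLpNorm (fun _ : ℝ => c) q (volume.restrict (Ioo 0 T)) ≤ ENNReal.ofReal (max 1 T * |c|) := by
  have hb : ∀ᵐ t ∂(volume.restrict (Ioo 0 T)), ‖(fun _ : ℝ => c) t‖ ≤ |c| := Eventually.of_forall fun _ => le_of_eq (Real.norm_eq_abs c)
  refine (eLpNorm_le_of_ae_bound hb).trans ?_
  rw [Measure.restrict_apply_univ, Real.volume_Ioo, sub_zero, ENNReal.ofReal_mul (le_max_of_le_left zero_le_one)]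
  gcongr
  have hexp0 : 0 ≤ q.toReal⁻¹ := inv_nonneg.2 ENNReal.toReal_nonneg
  have hexp1 : q.toReal⁻¹ ≤ 1 := by
    rcases eq_or_ne q ⊤ with rfl | hq'
    · simp
    · have h1 : 1 ≤ q.toReal := by
        rw [← ENNReal.toReal_one]; exact (ENNReal.toReal_le_toReal ENNReal.one_ne_top hq').2 hq
      exact inv_le_one_of_one_le₀ h1
  rcases le_total T 1 with hT1 | hT1
  · rw [max_eq_left hT1, ENNReal.ofReal_one]
    exact ENNReal.rpow_le_one (ENNReal.ofReal_le_one.2 hT1) hexp0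
  · rw [max_eq_right hT1]
    calc ENNReal.ofReal T ^ q.toReal⁻¹ ≤ ENNReal.ofReal T ^ (1 : ℝ) :=
          ENNReal.rpow_le_rpow_of_exponent_le (ENNReal.one_le_ofReal.2 hT1) hexp1
      _ = ENNReal.ofReal T := ENNReal.rpow_one _

/-- `L^q(0,T)` norms of continuous profiles through interval integrals (`q ≥ 1` real, `T ≥ 0`):
`‖φ‖_{L^q(0,T)} = (∫₀ᵀ |φ|^q)^{1/q}`. [folklore] -/
theorem eLpNorm_restrict_Ioo_eq_ofReal_rpow (hT : 0 ≤ T) (hφ : ContinuousOn φ (Icc 0 T)) {q : ℝ} (hq : 1 ≤ q) :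
    eLpNorm φ (ENNReal.ofReal q) (volume.restrict (Ioo 0 T)) = ENNReal.ofReal ((∫ t in (0 : ℝ)..T, |φ t| ^ q) ^ (1 / q)) := by
  have hq0 : 0 < q := by linarith
  obtain ⟨B, hB⟩ := (isCompact_Icc.image_of_continuousOn hφ).isBounded.exists_norm_le
  have hmeas : AEStronglyMeasurable φ (volume.restrict (Ioo 0 T)) :=
    (hφ.mono Ioo_subset_Icc_self).aestronglyMeasurable measurableSet_Ioo
  have hbd : ∀ᵐ t ∂(volume.restrict (Ioo 0 T)), ‖φ t‖ ≤ B :=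
    ae_restrict_of_forall_mem measurableSet_Ioo fun t ht => hB _ ⟨t, Ioo_subset_Icc_self ht, rfl⟩
  haveI : IsFiniteMeasure (volume.restrict (Ioo (0 : ℝ) T)) := ⟨by rw [Measure.restrict_apply_univ, Real.volume_Ioo]; exact ENNReal.ofReal_lt_top⟩
  have hmem : MemLp φ (ENNReal.ofReal q) (volume.restrict (Ioo 0 T)) := (memLp_top_of_bound hmeas B hbd).mono_exponent le_top
  rw [hmem.eLpNorm_eq_integral_rpow_norm (by simp [hq0]) ENNReal.ofReal_ne_top, ENNReal.toReal_ofReal hq0.le, one_div,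
    intervalIntegral.integral_of_le hT, integral_Ioc_eq_integral_Ioo]
  simp [Real.norm_eq_abs]

/-- Minkowski on `(0,T)` for continuous profiles, `q ≥ 1`. [folklore] -/
theorem eLpNorm_add_restrict_Ioo_le (hφ : ContinuousOn φ (Icc 0 T)) (hψ : ContinuousOn ψ (Icc 0 T)) (hq : 1 ≤ q) :
    eLpNorm (fun t => φ t + ψ t) q (volume.restrict (Ioo 0 T)) ≤
      eLpNorm φ q (volume.restrict (Ioo 0 T)) + eLpNorm ψ q (volume.restrict (Ioo 0 T)) :=
  eLpNorm_add_le ((hφ.mono Ioo_subset_Icc_self).aestronglyMeasurable measurableSet_Ioo)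
    ((hψ.mono Ioo_subset_Icc_self).aestronglyMeasurable measurableSet_Ioo) hq

/-- Minkowski on `(0,T)` for finite sums of continuous profiles, `q ≥ 1`. [folklore] -/
theorem eLpNorm_sum_restrict_Ioo_le {ι : Type*} (s : Finset ι) {φ : ι → ℝ → ℝ} (hφ : ∀ i ∈ s, ContinuousOn (φ i) (Icc 0 T))
    (hq : 1 ≤ q) :
    eLpNorm (fun t => ∑ i ∈ s, φ i t) q (volume.restrict (Ioo 0 T)) ≤ ∑ i ∈ s, eLpNorm (φ i) q (volume.restrict (Ioo 0 T)) := by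
  have h := eLpNorm_sum_le (s := s) (f := φ) (p := q) (μ := volume.restrict (Ioo 0 T))
    (fun i hi => ((hφ i hi).mono Ioo_subset_Icc_self).aestronglyMeasurable measurableSet_Ioo) hq
  rwa [Finset.sum_fn] at h

/-- Scaling a profile: `‖c φ‖_{L^q(0,T)} = |c| ‖φ‖_{L^q(0,T)}`. [folklore] -/
theorem eLpNorm_const_mul_restrict (c : ℝ) (φ : ℝ → ℝ) (q : ℝ≥0∞) (μ : Measure ℝ) :
    eLpNorm (fun t => c * φ t) q μ = ENNReal.ofReal |c| * eLpNorm φ q μ := by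
  rw [show (fun t => c * φ t) = c • φ from rfl, eLpNorm_const_smul, Real.enorm_eq_ofReal_abs]

end Time

/-! ## Slice tools on the probability torus -/

section Torus

variable {F : Type*} [NormedAddCommGroup F] [NormedSpace ℝ F] {p : ℝ≥0∞}

/-- `‖f • v‖_{L^p} = ‖v‖ ‖f‖_{L^p}` for a scalar `f` and a fixed vector `v`. [folklore] -/
theorem eLpNorm_smul_const_vec (f : UnitAddTorus d → ℝ) (v : F) (p : ℝ≥0∞) :
    eLpNorm (fun y => f y • v) p volume = ENNReal.ofReal ‖v‖ * eLpNorm f p volume := by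
  have e : (fun y => ‖f y • v‖) = fun y => ‖v‖ * ‖f y‖ := by funext y; rw [norm_smul, mul_comm]
  rw [← eLpNorm_norm (fun y => f y • v), e, show (fun y => ‖v‖ * ‖f y‖) = ‖v‖ • fun y => ‖f y‖ from rfl,
    eLpNorm_const_smul, eLpNorm_norm, Real.enorm_eq_ofReal (norm_nonneg v)]

/-- `‖a • f‖_{L^p} ≤ A ‖f‖_{L^p}` when `|a| ≤ A` pointwise. [folklore] -/
theorem eLpNorm_smul_le_of_abs_le {a : UnitAddTorus d → ℝ} {f : UnitAddTorus d → F} {A : ℝ} (ha : ∀ y, |a y| ≤ A) (p : ℝ≥0∞) :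
    eLpNorm (fun y => a y • f y) p volume ≤ ENNReal.ofReal A * eLpNorm f p volume :=
  eLpNorm_le_mul_eLpNorm_of_ae_le_mul (Eventually.of_forall fun y => by
    rw [norm_smul, Real.norm_eq_abs]; exact mul_le_mul_of_nonneg_right (ha y) (norm_nonneg _)) p

omit [NormedSpace ℝ F] in
/-- Monotonicity of `L^p(𝕋^d)` norms in the exponent for continuous functions. [folklore] -/
theorem eLpNorm_le_eLpNorm_of_le {f : UnitAddTorus d → F} (hf : Continuous f) {p p' : ℝ≥0∞} (hpp' : p ≤ p') :
    eLpNorm f p volume ≤ eLpNorm f p' volume :=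
  eLpNorm_le_eLpNorm_of_exponent_le hpp' hf.aestronglyMeasurable

end Torus

end Torus

end Literature.Analysis.FluidPDE
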